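import Literature.Computability.AlgebraicComplexity.DDS21TraceBackStep
import Literature.Computability.AlgebraicComplexity.UABPZCoefficients
import Literature.Computability.AlgebraicComplexity.DDS21GradedFractions
import HarnessLib

/-!
# DDS 2021, proof of Thm. 3.2: the trace-back ASSEMBLED over an abstract DiDIL transcript

Theorem-only file (cell `val-lit`, row X2-DDS21, brick B5 "trace back `f_0`" — the `k − 1` rounds
of Claims 3.7–3.8 and the last step, assembled; HOME/np/MEMO-t18g10-DDS21-B5-traceback.md §4:
"B5 can be written and LANDED before B4, against an abstract «DiDIL transcript» structure").
Source: P. Dutta, P. Dwivedi, N. Saxena, *Demystifying the border of depth-3 algebraic circuits*,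
FOCS 2021 / full version [DuttaDwivediSaxena2022] (held text `paper:galaxy-pdf-7641649743695546420`),
§3, proof of Thm. 3.2: "Roadmap" of Claim 3.7 (p0034 L897–906), the reduction step (p0034 L906 –
p0035 L931), Claim 3.8 (p0035 L934 – p0036 L951), "Size blowup" and the last step (p0036
L952–961).

The TRANSCRIPT (all hypotheses; frame: `z` = variable `0` of `MvPolynomial (Fin (n+1)) F`,
"`≡ (mod z^D)`" = equality after `truncDegreeOf 0 D`, `ε` absent): `r` rounds (`r = k − 1`), a
precision `d > deg f` with `r < d` ("`d_j`" = `d − j`, the case `v_{·,j} = 0` of every divisor,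
which is the generic-`α` situation), the DiDIL divisors `t_j = A_j/B_j ∈ F(x)[[z]]` given as pairs
of polynomials with `z`-free nonzero `z = 0` values, the VIRTUAL stage objects `f_j = N_j/E_j`
defined by `f_0 = Φ_α(f)`, `f_{j+1} = ∂_z (f_j/t_j)` (the sequences `N, E` are hypotheses tied by
this recursion — they carry no programs), Claim 3.8's `z = 0` values `(f_j/t_j)|_{z=0} = Nw_j/ew_j`
as cross-multiplied identities, and the TOP congruence "`f_r` is ABP/ABP modulo `z^{d−r}`"
(Claim 3.3 / the end of the DiDIL induction). CONCLUSION (`uabpComputes_of_traceBackTranscript`):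
`f` is computed by an ABP within budget `σ₀ ^ (648 · 6 ^ r)` for one parameter `σ₀ ≥ 2` dominating
`d` and the budgets of all transcript programs; and — THE EXPORT OF RECORD (cell ruling (138):
the stage objects are themselves of size `s^{O(7^j)}`, so only an exponent LINEAR in `r` keeps the
total inside the fact's `s^{O(k·7^k)}`) — `uabpComputes_of_traceBackTranscript_lin`:
`UABPComputes (σ₀ ^ (648 · r + 1458)) f`, from the AFFINE size recursion of the rounds
(`S_j ≤ 4 s² · S_{j+1} + O(s⁵)`, denominators additive; "Size blowup", p0036 L952–958).
`DDS2021_thm_3_2` stays OPEN by name (the DiDIL step producing such a transcript, bricks B4b/B4c,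
is not here). Ingredients: `truncDegreeOf_traceBack_top / _round`,
`UABPComputes.traceBackRoundNum / Den` (`DDS21TraceBackStep.lean`) and the last step
`uabpComputes_of_phi_truncDegreeOf_eq` (`DDS21TraceBackFinalStep.lean`).

The EULER SEAM (§ EulerSeam): the cell's `ε`-side bricks work with the Euler operator
`Σ x_i ∂_i ↔ z ∂_z`, whose stage objects are `z · f_j`; `truncDegreeOf_X_mul_zShift`,
`UABPComputes.zShift` and `exists_cancel_X_of_truncDegreeOf` divide an object / a congruence by `z`
with a program for the quotient, which is all a producer in that frame needs to instantiate the
transcript (imports `UABPZCoefficients.lean` for the `z^k`-coefficient programs).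

THE LINK (§ Link): a producer's stage objects live in the fraction field `F(z, x)` —
`g_0 = Φ_α(f)`, `g_{j+1} = z ∂_z (g_j / t_j)` (the DiDIL recursion (3.1)–(3.2) in the Euler
normalisation, `∂_z` extended to fractions by the quotient rule: `locDeriv` of
`DDS21GradedFractions.lean`); with the divisors fed as `t_j = z^{[j ≥ 1]} · A_j / B_j` and `N, E`
DEFINED by the transcript recursion, `traceBack_link` proves `g_j = z^{[j ≥ 1]} · N_j / E_j`
exactly, so that `hw0` and `htop` become statements about the producer's own objects.

0 definitions, 0 named facts. Honest framing: bookkeeping of a published 2021 proof; nothing here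
bears on VP versus VNP, which is NOT proved.
-/

open MvPolynomial
open Literature.RingTheory.MvPolynomial

open scoped BigOperators

namespace Literature.Computability.AlgebraicComplexity

namespace DDS2021

section Assembly

variable {F : Type*} [Field F] [CharZero F] {n : ℕ}

/-- **One round of the trace-back, packaged** (Claim 3.7 with Claim 3.8's `z = 0` value): from
"`den′ · f_{j+1} ≡ Num′ (mod z^M)`" (programs within `σ`) and the round-`j` transcript data
(programs within `σ ≥ max(M + 1, 2)`), polynomials `Num, den` with programs within any
`s' ≥ 182400 · σ^5`, `den ∈ F[x] ∖ {0}`, and `den · f_j ≡ Num (mod z^{M+1})` — read on the virtual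
fraction `f_j = P/E` as `den · P ≡ Num · E`.
[cite: DuttaDwivediSaxena2022, §3 proof of Thm. 3.2, Claims 3.7–3.8 and "Size blowup" (full version p0034 L906 – p0036 L958)] -/
theorem traceBack_round_known {M σ s' : ℕ}
    {P E A B Num' : MvPolynomial (Fin (n + 1)) F} {den' e a βn Nw ew : MvPolynomial (Fin n) F}
    (hH : truncDegreeOf 0 M (rename Fin.succ den' *
        (pderiv 0 (P * B) * (E * A) - P * B * pderiv 0 (E * A))) =
      truncDegreeOf 0 M (Num' * (E * A) ^ 2))
    (he : truncDegreeOf 0 1 E = rename Fin.succ e) (ha : truncDegreeOf 0 1 A = rename Fin.succ a)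
    (hβ : truncDegreeOf 0 1 B = rename Fin.succ βn)
    (he0 : e ≠ 0) (ha0 : a ≠ 0) (hβ0 : βn ≠ 0) (hden0 : den' ≠ 0) (hew0 : ew ≠ 0)
    (hw0 : rename Fin.succ ew * truncDegreeOf 0 1 (P * B) =
      rename Fin.succ Nw * truncDegreeOf 0 1 (E * A))
    (hE : UABPComputes σ E) (hA : UABPComputes σ A) (hB : UABPComputes σ B)
    (heP : UABPComputes σ e) (haP : UABPComputes σ a) (hβP : UABPComputes σ βn)
    (hNw : UABPComputes σ Nw) (hewP : UABPComputes σ ew)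
    (hNum' : UABPComputes σ Num') (hden' : UABPComputes σ den')
    (hM : M + 1 ≤ σ) (hσ : 2 ≤ σ) (hs' : 182400 * σ ^ 5 ≤ s') :
    ∃ (Num : MvPolynomial (Fin (n + 1)) F) (den : MvPolynomial (Fin n) F),
      UABPComputes s' Num ∧ UABPComputes s' den ∧ den ≠ 0 ∧
      truncDegreeOf 0 (M + 1) (rename Fin.succ den * P) =
        truncDegreeOf 0 (M + 1) (Num * E) := by
  have hinj : Function.Injective
      (rename (Fin.succ : Fin n → Fin (n + 1)) : MvPolynomial (Fin n) F → _) :=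
    rename_injective _ (Fin.succ_injective n)
  obtain ⟨b, hb_eq⟩ : ∃ b : MvPolynomial (Fin (n + 1)) F, b = rename Fin.succ (e * a) := ⟨_, rfl⟩
  -- `z = 0` values
  have hb : truncDegreeOf 0 1 (E * A) = b := by
    rw [truncDegreeOf_one_mul, he, ha, hb_eq, map_mul]
  have hb0 : b ≠ 0 := by
    rw [hb_eq]
    exact fun h0 => (mul_ne_zero he0 ha0) (hinj (by rw [h0, map_zero]))
  have hdz : (rename Fin.succ den' : MvPolynomial (Fin (n + 1)) F).degreeOf 0 = 0 :=
    degreeOf_zero_rename_succ _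
  have hewz : (rename Fin.succ ew : MvPolynomial (Fin (n + 1)) F).degreeOf 0 = 0 :=
    degreeOf_zero_rename_succ _
  -- the algebra of the round
  rw [hb] at hw0
  have halg := truncDegreeOf_traceBack_round (K := F) (σ := Fin (n + 1)) (i := (0 : Fin (n + 1)))
    (M := M) (P := P) (E := E) (A := A) (B := B) (Num' := Num') (den' := rename Fin.succ den')
    (Nw := rename Fin.succ Nw) (ew := rename Fin.succ ew) (b := b) (β := rename Fin.succ βn)
    hH hdz hb hb0 hβ hewz hw0
  -- programs: everything small is within `4 σ`
  have h4 : σ ≤ 4 * σ := by omega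
  have hbP : UABPComputes (4 * σ) b := by
    rw [hb_eq]
    exact ((heP.mul haP).rename Fin.succ).mono (by omega)
  have hw : UABPComputes (4 * σ) (E * A) := (hE.mul hA).mono (by omega)
  have hp0 : UABPComputes (4 * σ)
      (rename Fin.succ den' * rename Fin.succ Nw * b : MvPolynomial (Fin (n + 1)) F) := by
    rw [hb_eq]
    exact (((hden'.rename Fin.succ).mul (hNw.rename Fin.succ)).mul
      ((heP.mul haP).rename Fin.succ)).mono (by omega)
  have hHP : UABPComputes (4 * σ) (rename Fin.succ ew * Num' * (E * A)) :=
    (((hewP.rename Fin.succ).mul hNum').mul (hE.mul hA)).mono (by omega)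
  have hNum := UABPComputes.traceBackRoundNum (0 : Fin (n + 1)) (s := 4 * σ) (S := 4 * σ)
    (s' := s') (M := M) hw (hA.mono h4) (hB.mono h4) hHP hp0 hbP ((hβP.rename Fin.succ).mono h4)
    (by omega) (by omega) (by
      have e1 : 4 * (4 * σ) * (4 * σ) ^ 2 + 178 * (4 * σ) ^ 5 = 256 * σ ^ 3 + 182272 * σ ^ 5 := by
        ring
      have e2 : 2 * σ ^ 3 ≤ σ ^ 5 :=
        calc 2 * σ ^ 3 ≤ σ * σ * σ ^ 3 :=
              Nat.mul_le_mul_right _ (le_trans hσ (Nat.le_mul_of_pos_right σ (by omega)))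
          _ = σ ^ 5 := by ring
      omega)
  have hden : UABPComputes s' (βn ^ (M + 1) * (e * a) ^ (M + 1) * den' * ew) :=
    UABPComputes.traceBackRoundDen (s := 2 * σ) (hβP.mono (by omega)) ((heP.mul haP).mono (by omega))
      (hden'.mono (by omega)) (hewP.mono (by omega)) (by omega) (by omega) (by
        have e1 : 10 * (2 * σ) ^ 4 = 160 * σ ^ 4 := by ring
        have e2 : σ ^ 4 ≤ σ ^ 5 := Nat.pow_le_pow_right (by omega) (by norm_num)
        omega)
  have hden_eq : (rename Fin.succ (βn ^ (M + 1) * (e * a) ^ (M + 1) * den' * ew) :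
      MvPolynomial (Fin (n + 1)) F) =
      rename Fin.succ βn ^ (M + 1) * b ^ (M + 1) * rename Fin.succ den' * rename Fin.succ ew := by
    rw [map_mul, map_mul, map_mul, map_pow, map_pow, ← hb_eq]
  refine ⟨_, _, hNum, hden, ?_, ?_⟩
  · exact mul_ne_zero (mul_ne_zero (mul_ne_zero (pow_ne_zero _ hβ0)
      (pow_ne_zero _ (mul_ne_zero he0 ha0))) hden0) hew0
  · rw [hden_eq]
    exact halg

omit [CharZero F] in
/-- **The first round, packaged** ("`f_{k−1}` has a `poly(s_{k−1})`-size ABP/ABP", p0035 L917):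
from `f_r ≡ At/Bt (mod z^{M+1})` read on the virtual fraction (`N_r · Bt ≡ At · E_r`) with
programs within `σ ≥ max(M + 1, 2)`: `Num, den` within any `s' ≥ 34 · σ^3`.
[cite: DuttaDwivediSaxena2022, §3 proof of Thm. 3.2, Claim 3.7 (full version p0034 L906 – p0035 L918)] -/
theorem traceBack_top_known {M σ s' : ℕ} {P E At Bt : MvPolynomial (Fin (n + 1)) F}
    {βt : MvPolynomial (Fin n) F}
    (htop : truncDegreeOf 0 (M + 1) (P * Bt) = truncDegreeOf 0 (M + 1) (At * E))
    (hβ : truncDegreeOf 0 1 Bt = rename Fin.succ βt) (hβ0 : βt ≠ 0)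
    (hAt : UABPComputes σ At) (hBt : UABPComputes σ Bt) (hβP : UABPComputes σ βt)
    (hM : M + 1 ≤ σ) (hσ : 2 ≤ σ) (hs' : 34 * σ ^ 3 ≤ s') :
    ∃ (Num : MvPolynomial (Fin (n + 1)) F) (den : MvPolynomial (Fin n) F),
      UABPComputes s' Num ∧ UABPComputes s' den ∧ den ≠ 0 ∧
      truncDegreeOf 0 (M + 1) (rename Fin.succ den * P) =
        truncDegreeOf 0 (M + 1) (Num * E) := by
  have halg := truncDegreeOf_traceBack_top (S := F) (σ := Fin (n + 1)) (i := (0 : Fin (n + 1)))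
    (M := M) (P := P) (E := E) (A := At) (B := Bt) (β := rename Fin.succ βt) htop hβ
  have hInv := UABPComputes.truncInv hBt (hβP.rename Fin.succ) hM hσ
  refine ⟨_, βt ^ (M + 1), (hAt.mul hInv).mono ?_, (UABPComputes.traceBackDen hβP hM hσ).mono ?_,
    pow_ne_zero _ hβ0, ?_⟩
  · have e1 : σ ≤ σ ^ 3 := Nat.le_self_pow (by norm_num) σ
    omega
  · have e1 : σ ^ 2 ≤ σ ^ 3 := Nat.pow_le_pow_right (by omega) (by norm_num)
    omega
  · rw [map_pow]
    exact halg

/-- **The last step, packaged** (`j = 0`: `E_0 = 1`, `N_0 = Φ_α(f)`): from `den · Φ_α(f) ≡ Num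
(mod z^d)`, `deg f < d ≤ σ`, programs within `σ ≥ 2`: an ABP for `f` within budget `σ^27`
("eliminate the division … apply `Φ^{-1}`", via `uabpComputes_of_phi_truncDegreeOf_eq`).
[cite: DuttaDwivediSaxena2022, §3 proof of Thm. 3.2, "Size blowup" (full version p0036 L957–961)] -/
theorem uabpComputes_of_known_zero {d σ : ℕ} (f : MvPolynomial (Fin n) F) (α : Fin n → F)
    {Num : MvPolynomial (Fin (n + 1)) F} {den : MvPolynomial (Fin n) F}
    (hcongr : truncDegreeOf 0 d (rename Fin.succ den *
        aeval (fun i : Fin n => (X 0 * X i.succ + C (α i) : MvPolynomial (Fin (n + 1)) F)) f) =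
      truncDegreeOf 0 d (Num * 1))
    (hNum : UABPComputes σ Num) (hden : UABPComputes σ den) (hden0 : den ≠ 0)
    (hdeg : f.totalDegree < d) (hd : d ≤ σ) (hσ : 2 ≤ σ) : UABPComputes (σ ^ 27) f := by
  rw [mul_one] at hcongr
  have h := uabpComputes_of_phi_truncDegreeOf_eq (s := σ ^ 3 + 2) α hNum hden hden0 hcongr hdeg
    (by omega) ?_ ?_ ?_
  · refine h.mono ?_
    have e1 : σ ^ 3 + 2 ≤ 2 * σ ^ 3 := by
      have : 2 ≤ σ ^ 3 := le_trans hσ (Nat.le_self_pow (by norm_num) σ)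
      omega
    have e2 : 100 * (σ ^ 3 + 2) ^ 5 ≤ 100 * (2 * σ ^ 3) ^ 5 :=
      Nat.mul_le_mul_left 100 (Nat.pow_le_pow_left e1 5)
    have e3 : 100 * (2 * σ ^ 3) ^ 5 = 3200 * σ ^ 15 := by ring
    have e5 : 3200 * σ ^ 15 ≤ σ ^ 27 := by
      calc 3200 * σ ^ 15 ≤ 2 ^ 12 * σ ^ 15 := Nat.mul_le_mul_right _ (by norm_num)
        _ ≤ σ ^ 12 * σ ^ 15 := Nat.mul_le_mul_right _ (Nat.pow_le_pow_left hσ 12)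
        _ = σ ^ 27 := by ring
    omega
  · have e1 : d * (σ * d) ≤ σ * (σ * σ) := Nat.mul_le_mul hd (Nat.mul_le_mul_left σ hd)
    have e2 : σ * (σ * σ) = σ ^ 3 := by ring
    omega
  · have : σ ≤ σ ^ 3 := Nat.le_self_pow (by norm_num) σ
    omega
  · have : 2 * σ ≤ σ ^ 3 :=
      calc 2 * σ ≤ σ * σ := Nat.mul_le_mul_right σ hσ
        _ ≤ σ * σ * σ := Nat.le_mul_of_pos_right _ (by omega)
        _ = σ ^ 3 := by ring
    omega

/-! ### The exponent bookkeeping ("Size blowup": `S_j = s^{O((k−j)·7^k)}`) -/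

/-- `34 · σ^3 ≤ σ^24` for `σ ≥ 2`. [folklore] -/
private theorem top_budget_le {σ : ℕ} (hσ : 2 ≤ σ) : 34 * σ ^ 3 ≤ σ ^ 24 := by
  calc 34 * σ ^ 3 ≤ 2 ^ 21 * σ ^ 3 := Nat.mul_le_mul_right _ (by norm_num)
    _ ≤ σ ^ 21 * σ ^ 3 := Nat.mul_le_mul_right _ (Nat.pow_le_pow_left hσ 21)
    _ = σ ^ 24 := by ring

/-- One parameter dominates its powers' bases: `σ ≤ σ^(24·6^i)`. [folklore] -/
private theorem le_round_budget {σ : ℕ} (hσ : 2 ≤ σ) (i : ℕ) : σ ≤ σ ^ (24 * 6 ^ i) := by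
  calc σ = σ ^ 1 := (pow_one σ).symm
    _ ≤ σ ^ (24 * 6 ^ i) := Nat.pow_le_pow_right (by omega)
        (le_trans (Nat.one_le_pow i 6 (by norm_num)) (Nat.le_mul_of_pos_left _ (by norm_num)))

/-- The round recursion of the budgets: `182400 · (σ^(24·6^i))^5 ≤ σ^(24·6^(i+1))`. [folklore] -/
private theorem round_budget_le {σ : ℕ} (hσ : 2 ≤ σ) (i : ℕ) :
    182400 * (σ ^ (24 * 6 ^ i)) ^ 5 ≤ σ ^ (24 * 6 ^ (i + 1)) := by
  have h1 : (σ ^ (24 * 6 ^ i)) ^ 5 = σ ^ (120 * 6 ^ i) := by rw [← pow_mul]; ring_nf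
  have h2 : σ ^ (24 * 6 ^ (i + 1)) = σ ^ (24 * 6 ^ i) * σ ^ (120 * 6 ^ i) := by
    rw [← pow_add]; ring_nf
  have h3 : 182400 ≤ σ ^ (24 * 6 ^ i) :=
    calc 182400 ≤ 2 ^ 24 := by norm_num
      _ ≤ σ ^ 24 := Nat.pow_le_pow_left hσ 24
      _ ≤ σ ^ (24 * 6 ^ i) := Nat.pow_le_pow_right (by omega)
          (Nat.le_mul_of_pos_right 24 (Nat.one_le_pow i 6 (by norm_num)))
  rw [h1, h2]
  exact Nat.mul_le_mul_right _ h3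

/-- **DDS Thm. 3.2, the trace-back ASSEMBLED (Claims 3.7–3.8, `k − 1` rounds, and the last step),
over an abstract DiDIL transcript.** Given: `d > deg f`, `r < d` rounds; virtual stage objects
`f_j = N_j/E_j` tied by `N_0 = Φ_α(f)`, `E_0 = 1`, `f_{j+1} = ∂_z(f_j/t_j)` for the divisors
`t_j = A_j/B_j` (quotient rule on representatives: `N_{j+1} = ∂_z(N_j B_j)·(E_j A_j) − N_j B_j·∂_z(E_j A_j)`,
`E_{j+1} = (E_j A_j)²`); `z = 0` values of `E_j, A_j, B_j` that are `z`-free and NONZERO (the case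
`v_{·,j} = 0`, i.e. `d_j = d − j`); Claim 3.8's values `(f_j/t_j)|_{z=0} = Nw_j/ew_j`; the top
congruence `f_r ≡ At/Bt (mod z^{d−r})` ("`f_{k−1}` has a `poly`-size ABP/ABP", Claim 3.3 at the end
of DiDIL); programs for all the named polynomials within one budget `σ₀ ≥ max(d, 2)`. Then `f` is
computed by an ABP with univariate labels within budget `σ₀ ^ (648 · 6^r)` — "`S_0 = s^{O(k·7^k)}` …
eliminate the division … apply `Φ^{-1}`". The transcript itself (the DiDIL step over `F(ε)` and its
`ε → 0` limits, Claims 3.4–3.6) is NOT produced here; `DDS2021_thm_3_2` stays OPEN by name.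
[cite: DuttaDwivediSaxena2022, §3 proof of Thm. 3.2, Claims 3.7–3.8 and "Size blowup" (full version p0034 L897 – p0036 L961)] -/
theorem uabpComputes_of_traceBackTranscript {r d σ₀ : ℕ} (f : MvPolynomial (Fin n) F)
    (α : Fin n → F) (N E A B : ℕ → MvPolynomial (Fin (n + 1)) F)
    (e a βn Nw ew : ℕ → MvPolynomial (Fin n) F)
    {At Bt : MvPolynomial (Fin (n + 1)) F} {βt : MvPolynomial (Fin n) F}
    (hN0 : N 0 = aeval (fun i : Fin n => (X 0 * X i.succ + C (α i) : MvPolynomial (Fin (n + 1)) F)) f)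
    (hE0 : E 0 = 1)
    (hNs : ∀ j < r, N (j + 1) = pderiv 0 (N j * B j) * (E j * A j) - N j * B j * pderiv 0 (E j * A j))
    (hEs : ∀ j < r, E (j + 1) = (E j * A j) ^ 2)
    (he : ∀ j < r, truncDegreeOf 0 1 (E j) = rename Fin.succ (e j))
    (ha : ∀ j < r, truncDegreeOf 0 1 (A j) = rename Fin.succ (a j))
    (hβ : ∀ j < r, truncDegreeOf 0 1 (B j) = rename Fin.succ (βn j))
    (he0 : ∀ j < r, e j ≠ 0) (ha0 : ∀ j < r, a j ≠ 0) (hβ0 : ∀ j < r, βn j ≠ 0)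
    (hew0 : ∀ j < r, ew j ≠ 0)
    (hw0 : ∀ j < r, rename Fin.succ (ew j) * truncDegreeOf 0 1 (N j * B j) =
      rename Fin.succ (Nw j) * truncDegreeOf 0 1 (E j * A j))
    (hEP : ∀ j < r, UABPComputes σ₀ (E j)) (hAP : ∀ j < r, UABPComputes σ₀ (A j))
    (hBP : ∀ j < r, UABPComputes σ₀ (B j)) (heP : ∀ j < r, UABPComputes σ₀ (e j))
    (haP : ∀ j < r, UABPComputes σ₀ (a j)) (hβP : ∀ j < r, UABPComputes σ₀ (βn j))
    (hNwP : ∀ j < r, UABPComputes σ₀ (Nw j)) (hewP : ∀ j < r, UABPComputes σ₀ (ew j))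
    (htop : truncDegreeOf 0 (d - r) (N r * Bt) = truncDegreeOf 0 (d - r) (At * E r))
    (hβt : truncDegreeOf 0 1 Bt = rename Fin.succ βt) (hβt0 : βt ≠ 0)
    (hAtP : UABPComputes σ₀ At) (hBtP : UABPComputes σ₀ Bt) (hβtP : UABPComputes σ₀ βt)
    (hdeg : f.totalDegree < d) (hrd : r < d) (hdσ : d ≤ σ₀) (hσ : 2 ≤ σ₀) :
    UABPComputes (σ₀ ^ (648 * 6 ^ r)) f := by
  -- the invariant after `i` rounds from the top: stage `r − i`, modulus `d − r + i`
  have key : ∀ i, i ≤ r → ∃ (Num : MvPolynomial (Fin (n + 1)) F) (den : MvPolynomial (Fin n) F),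
      UABPComputes (σ₀ ^ (24 * 6 ^ i)) Num ∧ UABPComputes (σ₀ ^ (24 * 6 ^ i)) den ∧ den ≠ 0 ∧
      truncDegreeOf 0 (d - r + i) (rename Fin.succ den * N (r - i)) =
        truncDegreeOf 0 (d - r + i) (Num * E (r - i)) := by
    intro i
    induction i with
    | zero =>
      intro _
      have hM : d - r = d - r - 1 + 1 := by omega
      rw [hM] at htop
      obtain ⟨Num, den, h1, h2, h3, h4⟩ := traceBack_top_known (M := d - r - 1) (σ := σ₀)
        (s' := σ₀ ^ 24) htop hβt hβt0 hAtP hBtP hβtP (by omega) hσ (top_budget_le hσ)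
      refine ⟨Num, den, ?_, ?_, h3, ?_⟩
      · simpa using h1
      · simpa using h2
      · have e0 : d - r + 0 = d - r - 1 + 1 := by omega
        simp only [e0, Nat.sub_zero]
        exact h4
    | succ i ih =>
      intro hi
      obtain ⟨Num', den', hNum', hden', hden0', hcongr'⟩ := ih (by omega)
      have hjr : r - (i + 1) < r := by omega
      have hj1 : r - i = r - (i + 1) + 1 := by omega
      rw [hj1, hNs _ hjr, hEs _ hjr] at hcongr'
      have hσ₁ : 2 ≤ σ₀ ^ (24 * 6 ^ i) := le_trans hσ (le_round_budget hσ i)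
      have hle : σ₀ ≤ σ₀ ^ (24 * 6 ^ i) := le_round_budget hσ i
      obtain ⟨Num, den, h1, h2, h3, h4⟩ := traceBack_round_known (M := d - r + i)
        (σ := σ₀ ^ (24 * 6 ^ i)) (s' := σ₀ ^ (24 * 6 ^ (i + 1))) hcongr' (he _ hjr) (ha _ hjr)
        (hβ _ hjr) (he0 _ hjr) (ha0 _ hjr) (hβ0 _ hjr) hden0' (hew0 _ hjr) (hw0 _ hjr)
        ((hEP _ hjr).mono hle) ((hAP _ hjr).mono hle) ((hBP _ hjr).mono hle)
        ((heP _ hjr).mono hle) ((haP _ hjr).mono hle) ((hβP _ hjr).mono hle)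
        ((hNwP _ hjr).mono hle) ((hewP _ hjr).mono hle) hNum' hden' (by omega) hσ₁
        (round_budget_le hσ i)
      exact ⟨Num, den, h1, h2, h3, h4⟩
  -- `i = r`: stage `0`, modulus `d`
  obtain ⟨Num, den, h1, h2, h3, h4⟩ := key r le_rfl
  rw [Nat.sub_self, show d - r + r = d from by omega, hN0, hE0] at h4
  have h := uabpComputes_of_known_zero f α h4 h1 h2 h3 hdeg
    (le_trans hdσ (le_round_budget hσ r)) (le_trans hσ (le_round_budget hσ r))
  rw [← pow_mul] at h
  refine h.mono (le_of_eq ?_)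
  ring_nf

end Assembly

/-! ## The Euler seam: dividing a stage object by `z`

The `ε`-side of the cell's DiDIL formalisation works in the graded `x`-frame with the Euler operator
`E = Σ x_i ∂_i ↔ z ∂_z` (bricks B4a–c), whose stage objects are `g_j = z · f_j` (`j ≥ 1`) for the
print's `f_j` ("Euler valuation = print valuation + 1"). The transcript above is in the print's
`∂_z` form; an Euler-form producer divides its objects by `z`. For VIRTUAL objects this is free
(define `N_j` accordingly and prove the recursion); where a PROGRAM is needed (the top numerator,
a stage numerator) the following lemmas do it: the degree shift
`∑_{k<M} z^k · coeff_{k+1}(f)` of a polynomial `f` with `f|_{z=0} = 0` satisfies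
`z · shift ≡ f (mod z^{M+1})` and inherits a program (`UABPComputes.zShift`), and a congruence
`z · P ≡ Q · E (mod z^{M+1})` with `E|_{z=0}` a nonzero `z`-free polynomial can be divided by `z`
(`exists_cancel_X_of_truncDegreeOf`). -/

section EulerSeam

variable {F : Type*} [Field F] {n : ℕ}

/-- **The degree shift**: if `f|_{z=0} = 0` then `z · ∑_{k<M} z^k · coeff_{k+1}(f) ≡ f (mod z^{M+1})`
("`f_1 = ∑ C_i z^i`" read one degree down).
[cite: DuttaDwivediSaxena2022, §3 proof of Thm. 3.2, Claim 3.7 (full version p0034 L904–913)] -/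
theorem truncDegreeOf_X_mul_zShift (M : ℕ) (f : MvPolynomial (Fin (n + 1)) F)
    (h0 : truncDegreeOf 0 1 f = 0) :
    truncDegreeOf 0 (M + 1) (X 0 * ∑ k ∈ Finset.range M,
        (X 0 : MvPolynomial (Fin (n + 1)) F) ^ k *
          rename Fin.succ (Polynomial.coeff (finSuccEquiv F n f) (k + 1))) =
      truncDegreeOf 0 (M + 1) f := by
  classical
  have hG : (X 0 * ∑ k ∈ Finset.range M, (X 0 : MvPolynomial (Fin (n + 1)) F) ^ k *
        rename Fin.succ (Polynomial.coeff (finSuccEquiv F n f) (k + 1))) =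
      ∑ k ∈ Finset.range M, weightedHomogeneousComponent (Pi.single 0 1) (k + 1) f := by
    rw [Finset.mul_sum]
    refine Finset.sum_congr rfl fun k _ => ?_
    rw [weightedHomogeneousComponent_single_zero_eq, pow_succ', mul_assoc]
  have hT : truncDegreeOf 0 (M + 1) f =
      ∑ k ∈ Finset.range M, weightedHomogeneousComponent (Pi.single 0 1) (k + 1) f := by
    rw [truncDegreeOf_apply, Finset.sum_range_succ', ← truncDegreeOf_one, h0, add_zero]
  rw [hG, ← hT, truncDegreeOf_truncDegreeOf, min_self]

/-- **A program for the degree shift** (per `k`: one edge `z^k` in series with the re-indexed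
coefficient program; parallel composition): within `7 · s^3` when `f` has a program within `s`
and `M ≤ s`, `2 ≤ s`. [cite: DuttaDwivediSaxena2022, §3 proof of Thm. 3.2, Claim 3.7 and "Size blowup" (full version p0034 L910–913, p0036 L952–956)] -/
theorem UABPComputes.zShift {s M : ℕ} {f : MvPolynomial (Fin (n + 1)) F} (hf : UABPComputes s f)
    (hM : M ≤ s) (hs : 2 ≤ s) :
    UABPComputes (7 * s ^ 3) (∑ k ∈ Finset.range M,
        (X 0 : MvPolynomial (Fin (n + 1)) F) ^ k *
          MvPolynomial.rename Fin.succ (Polynomial.coeff (finSuccEquiv F n f) (k + 1))) := by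
  classical
  have hterm : ∀ k : Fin M, UABPComputes (3 * s ^ 2)
      ((X 0 : MvPolynomial (Fin (n + 1)) F) ^ (k : ℕ) *
        MvPolynomial.rename Fin.succ (Polynomial.coeff (finSuccEquiv F n f) ((k : ℕ) + 1))) := by
    intro k
    have hk : (k : ℕ) + 1 ≤ M := by have := k.isLt; omega
    have h1 : UABPComputes (2 + (k : ℕ) * 2) ((X 0 : MvPolynomial (Fin (n + 1)) F) ^ (k : ℕ)) :=
      (UABPComputesLen.of_X (S := 2) le_rfl (0 : Fin (n + 1))).uabpComputes.pow (k : ℕ)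
    have h2 : UABPComputes (s * (M + 1))
        (MvPolynomial.rename Fin.succ (Polynomial.coeff (finSuccEquiv F n f) ((k : ℕ) + 1)) :
          MvPolynomial (Fin (n + 1)) F) :=
      (hf.finSuccEquivCoeff (D := M) hk).rename Fin.succ
    refine (h1.mul h2).mono ?_
    have e1 : (k : ℕ) * 2 ≤ s * 2 := Nat.mul_le_mul_right 2 (by omega)
    have e2 : s * (M + 1) ≤ s * (s + 1) := Nat.mul_le_mul_left s (by omega)
    have e3 : 4 * s + 2 ≤ 2 * (s * s) + 2 * s := by nlinarith
    rw [sq]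
    nlinarith [e1, e2, e3]
  rw [Finset.sum_range]
  refine (UABPComputes.sum (S := 3 * s ^ 2) (by nlinarith) _ hterm).mono ?_
  rw [Fintype.card_fin]
  have e4 : M * (3 * s ^ 2 + 3 * s ^ 2) ≤ s * (3 * s ^ 2 + 3 * s ^ 2) := Nat.mul_le_mul_right _ hM
  have e5 : s * (3 * s ^ 2 + 3 * s ^ 2) = 6 * s ^ 3 := by ring
  have e6 : 2 ≤ s ^ 3 := le_trans hs (Nat.le_self_pow (by norm_num) s)
  omega

/-- **Dividing a congruence by `z`** (the seam between an Euler-form stage object `g = z · f` and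
the print's `f`): if `z · P ≡ Q · E (mod z^{M+1})` where `E|_{z=0}` is a nonzero `z`-free
polynomial and `Q` has a program within `σ ≥ max(M, 2)`, then `Q|_{z=0} = 0` and
`P ≡ Q₁ · E (mod z^M)` for the degree shift `Q₁` of `Q`, which has a program within `7 · σ^3`.
[cite: DuttaDwivediSaxena2022, §3 proof of Thm. 3.2, Claim 3.7 (full version p0034 L904–913, p0035 L926–931)] -/
theorem exists_cancel_X_of_truncDegreeOf {M σ : ℕ} {P Q E : MvPolynomial (Fin (n + 1)) F}
    {e : MvPolynomial (Fin n) F}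
    (h : truncDegreeOf 0 (M + 1) (X 0 * P) = truncDegreeOf 0 (M + 1) (Q * E))
    (he : truncDegreeOf 0 1 E = rename Fin.succ e) (he0 : e ≠ 0) (hQ : UABPComputes σ Q)
    (hM : M ≤ σ) (hσ : 2 ≤ σ) :
    ∃ Q₁ : MvPolynomial (Fin (n + 1)) F, UABPComputes (7 * σ ^ 3) Q₁ ∧
      truncDegreeOf 0 M P = truncDegreeOf 0 M (Q₁ * E) := by
  classical
  -- `Q|_{z=0} = 0`
  have hzP : truncDegreeOf 0 1 (X 0 * P : MvPolynomial (Fin (n + 1)) F) = 0 := by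
    have h1 := truncDegreeOf_X_pow_mul (R := F) (0 : Fin (n + 1)) 0 1 P
    rw [pow_one, Nat.zero_add, truncDegreeOf_zero_right, mul_zero] at h1
    exact h1
  have hQ0 : truncDegreeOf 0 1 Q = 0 := by
    have h1 := truncDegreeOf_congr_mono (show 1 ≤ M + 1 by omega) h
    rw [hzP, truncDegreeOf_one_mul, he] at h1
    have he0' : (rename Fin.succ e : MvPolynomial (Fin (n + 1)) F) ≠ 0 := fun h0 =>
      he0 (rename_injective _ (Fin.succ_injective n) (by rw [h0, map_zero]))
    rcases mul_eq_zero.1 h1.symm with h2 | h2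
    · exact h2
    · exact absurd h2 he0'
  -- the degree shift `Q₁` with `z · Q₁ ≡ Q`
  refine ⟨_, hQ.zShift hM hσ, ?_⟩
  have hshift := truncDegreeOf_X_mul_zShift M Q hQ0
  have h2 : truncDegreeOf 0 (M + 1) (X 0 * P) =
      truncDegreeOf 0 (M + 1) (X 0 * ((∑ k ∈ Finset.range M,
        (X 0 : MvPolynomial (Fin (n + 1)) F) ^ k *
          rename Fin.succ (Polynomial.coeff (finSuccEquiv F n Q) (k + 1))) * E)) := by
    rw [h, ← mul_assoc]
    exact truncDegreeOf_mul_congr hshift.symm rfl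
  -- cancel `z`
  have h3 := truncDegreeOf_X_pow_mul (R := F) (0 : Fin (n + 1)) M 1 P
  have h4 := truncDegreeOf_X_pow_mul (R := F) (0 : Fin (n + 1)) M 1
    ((∑ k ∈ Finset.range M, (X 0 : MvPolynomial (Fin (n + 1)) F) ^ k *
      rename Fin.succ (Polynomial.coeff (finSuccEquiv F n Q) (k + 1))) * E)
  rw [pow_one] at h3 h4
  rw [h3, h4] at h2
  exact mul_left_cancel₀ (X_ne_zero (0 : Fin (n + 1))) h2

end EulerSeam

/-! ## The export of record: budgets with exponent LINEAR in the number of rounds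

"Size blowup" (p0036 L952–958): `S_j = S_{j+1} + S'_j`, i.e. the trace-back is an AFFINE
recursion in the numerator budget (slope polynomial in the stage data) and ADDITIVE in the
denominator budget — so the assembled exponent is linear in `r`. -/

section Linear

variable {F : Type*} [Field F] [CharZero F] {n : ℕ}

/-- **One round, three budgets** (small transcript data within `σ`, the incoming numerator within
`S`, the incoming denominator within `T`): the outgoing numerator is within
`4 · (S + 3σ) · (T + 3σ)² + 178 · (T + 3σ)⁵` (affine in `S`) and the outgoing denominator within
`T + 3 (M+1) σ + σ + 4` (additive).
[cite: DuttaDwivediSaxena2022, §3 proof of Thm. 3.2, Claims 3.7–3.8 and "Size blowup" (full version p0034 L906 – p0036 L958)] -/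
theorem traceBack_round_known_lin {M σ S T : ℕ}
    {P E A B Num' : MvPolynomial (Fin (n + 1)) F} {den' e a βn Nw ew : MvPolynomial (Fin n) F}
    (hH : truncDegreeOf 0 M (rename Fin.succ den' *
        (pderiv 0 (P * B) * (E * A) - P * B * pderiv 0 (E * A))) =
      truncDegreeOf 0 M (Num' * (E * A) ^ 2))
    (he : truncDegreeOf 0 1 E = rename Fin.succ e) (ha : truncDegreeOf 0 1 A = rename Fin.succ a)
    (hβ : truncDegreeOf 0 1 B = rename Fin.succ βn)
    (he0 : e ≠ 0) (ha0 : a ≠ 0) (hβ0 : βn ≠ 0) (hden0 : den' ≠ 0) (hew0 : ew ≠ 0)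
    (hw0 : rename Fin.succ ew * truncDegreeOf 0 1 (P * B) =
      rename Fin.succ Nw * truncDegreeOf 0 1 (E * A))
    (hE : UABPComputes σ E) (hA : UABPComputes σ A) (hB : UABPComputes σ B)
    (heP : UABPComputes σ e) (haP : UABPComputes σ a) (hβP : UABPComputes σ βn)
    (hNw : UABPComputes σ Nw) (hewP : UABPComputes σ ew)
    (hNum' : UABPComputes S Num') (hden' : UABPComputes T den')
    (hM : M + 1 ≤ σ) (hσ : 2 ≤ σ) :
    ∃ (Num : MvPolynomial (Fin (n + 1)) F) (den : MvPolynomial (Fin n) F),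
      UABPComputes (4 * (S + 3 * σ) * (T + 3 * σ) ^ 2 + 178 * (T + 3 * σ) ^ 5) Num ∧
      UABPComputes (T + 3 * (M + 1) * σ + σ + 4) den ∧ den ≠ 0 ∧
      truncDegreeOf 0 (M + 1) (rename Fin.succ den * P) =
        truncDegreeOf 0 (M + 1) (Num * E) := by
  have hinj : Function.Injective
      (rename (Fin.succ : Fin n → Fin (n + 1)) : MvPolynomial (Fin n) F → _) :=
    rename_injective _ (Fin.succ_injective n)
  obtain ⟨b, hb_eq⟩ : ∃ b : MvPolynomial (Fin (n + 1)) F, b = rename Fin.succ (e * a) := ⟨_, rfl⟩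
  have hb : truncDegreeOf 0 1 (E * A) = b := by
    rw [truncDegreeOf_one_mul, he, ha, hb_eq, map_mul]
  have hb0 : b ≠ 0 := by
    rw [hb_eq]
    exact fun h0 => (mul_ne_zero he0 ha0) (hinj (by rw [h0, map_zero]))
  have hdz : (rename Fin.succ den' : MvPolynomial (Fin (n + 1)) F).degreeOf 0 = 0 :=
    degreeOf_zero_rename_succ _
  have hewz : (rename Fin.succ ew : MvPolynomial (Fin (n + 1)) F).degreeOf 0 = 0 :=
    degreeOf_zero_rename_succ _
  rw [hb] at hw0
  have halg := truncDegreeOf_traceBack_round (K := F) (σ := Fin (n + 1)) (i := (0 : Fin (n + 1)))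
    (M := M) (P := P) (E := E) (A := A) (B := B) (Num' := Num') (den' := rename Fin.succ den')
    (Nw := rename Fin.succ Nw) (ew := rename Fin.succ ew) (b := b) (β := rename Fin.succ βn)
    hH hdz hb hb0 hβ hewz hw0
  -- programs: small data within `T + 3σ`, the incoming numerator within `S + 3σ`
  have hbP : UABPComputes (T + 3 * σ) b := by
    rw [hb_eq]
    exact ((heP.mul haP).rename Fin.succ).mono (by omega)
  have hw : UABPComputes (T + 3 * σ) (E * A) := (hE.mul hA).mono (by omega)
  have hp0 : UABPComputes (T + 3 * σ)
      (rename Fin.succ den' * rename Fin.succ Nw * b : MvPolynomial (Fin (n + 1)) F) := by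
    rw [hb_eq]
    exact (((hden'.rename Fin.succ).mul (hNw.rename Fin.succ)).mul
      ((heP.mul haP).rename Fin.succ)).mono (by omega)
  have hHP : UABPComputes (S + 3 * σ) (rename Fin.succ ew * Num' * (E * A)) :=
    (((hewP.rename Fin.succ).mul hNum').mul (hE.mul hA)).mono (by omega)
  have hNum := UABPComputes.traceBackRoundNum (0 : Fin (n + 1)) (s := T + 3 * σ) (S := S + 3 * σ)
    (s' := 4 * (S + 3 * σ) * (T + 3 * σ) ^ 2 + 178 * (T + 3 * σ) ^ 5) (M := M) hw
    (hA.mono (by omega)) (hB.mono (by omega)) hHP hp0 hbP ((hβP.rename Fin.succ).mono (by omega))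
    (by omega) (by omega) le_rfl
  have hden : UABPComputes (T + 3 * (M + 1) * σ + σ + 4)
      (βn ^ (M + 1) * (e * a) ^ (M + 1) * den' * ew) :=
    ((((hβP.pow (M + 1)).mul ((heP.mul haP).pow (M + 1))).mul hden').mul hewP).mono
      (le_of_eq (by ring))
  have hden_eq : (rename Fin.succ (βn ^ (M + 1) * (e * a) ^ (M + 1) * den' * ew) :
      MvPolynomial (Fin (n + 1)) F) =
      rename Fin.succ βn ^ (M + 1) * b ^ (M + 1) * rename Fin.succ den' * rename Fin.succ ew := by
    rw [map_mul, map_mul, map_mul, map_pow, map_pow, ← hb_eq]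
  refine ⟨_, _, hNum, hden, ?_, ?_⟩
  · exact mul_ne_zero (mul_ne_zero (mul_ne_zero (pow_ne_zero _ hβ0)
      (pow_ne_zero _ (mul_ne_zero he0 ha0))) hden0) hew0
  · rw [hden_eq]
    exact halg

omit [CharZero F] in
/-- **The first round, two budgets**: numerator within `34 σ³`, denominator `βt^{M+1}` within
`2 + (M+1) σ`. [cite: DuttaDwivediSaxena2022, §3 proof of Thm. 3.2, Claim 3.7 (full version p0034 L906 – p0035 L918)] -/
theorem traceBack_top_known_lin {M σ : ℕ} {P E At Bt : MvPolynomial (Fin (n + 1)) F}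
    {βt : MvPolynomial (Fin n) F}
    (htop : truncDegreeOf 0 (M + 1) (P * Bt) = truncDegreeOf 0 (M + 1) (At * E))
    (hβ : truncDegreeOf 0 1 Bt = rename Fin.succ βt) (hβ0 : βt ≠ 0)
    (hAt : UABPComputes σ At) (hBt : UABPComputes σ Bt) (hβP : UABPComputes σ βt)
    (hM : M + 1 ≤ σ) (hσ : 2 ≤ σ) :
    ∃ (Num : MvPolynomial (Fin (n + 1)) F) (den : MvPolynomial (Fin n) F),
      UABPComputes (34 * σ ^ 3) Num ∧ UABPComputes (2 + (M + 1) * σ) den ∧ den ≠ 0 ∧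
      truncDegreeOf 0 (M + 1) (rename Fin.succ den * P) =
        truncDegreeOf 0 (M + 1) (Num * E) := by
  have halg := truncDegreeOf_traceBack_top (S := F) (σ := Fin (n + 1)) (i := (0 : Fin (n + 1)))
    (M := M) (P := P) (E := E) (A := At) (B := Bt) (β := rename Fin.succ βt) htop hβ
  have hInv := UABPComputes.truncInv hBt (hβP.rename Fin.succ) hM hσ
  refine ⟨_, βt ^ (M + 1), (hAt.mul hInv).mono ?_, hβP.pow (M + 1), pow_ne_zero _ hβ0, ?_⟩
  · have e1 : σ ≤ σ ^ 3 := Nat.le_self_pow (by norm_num) σ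
    omega
  · rw [map_pow]
    exact halg

/-- The denominator budgets stay small: `2 + dσ + i(3dσ + σ + 4) + 3σ ≤ σ⁶` for `i ≤ r < d ≤ σ`,
`σ ≥ 2`. [folklore] -/
private theorem den_budget_le {σ d r i : ℕ} (hσ : 2 ≤ σ) (hd : d ≤ σ) (hr : r < d) (hi : i ≤ r) :
    2 + d * σ + i * (3 * d * σ + σ + 4) + 3 * σ ≤ σ ^ 6 := by
  have hiσ : i ≤ σ := by omega
  have e1 : d * σ ≤ σ * σ := Nat.mul_le_mul_right σ hd
  have e2 : i * (3 * d * σ + σ + 4) ≤ σ * (3 * (σ * σ) + σ + 4) :=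
    Nat.mul_le_mul hiσ (by nlinarith)
  have e3 : σ * (3 * (σ * σ) + σ + 4) = 3 * (σ * σ * σ) + σ * σ + 4 * σ := by ring
  have h4 : 4 ≤ σ * σ := Nat.mul_le_mul hσ hσ
  have h8 : 8 ≤ σ * σ * σ := Nat.mul_le_mul h4 hσ
  have e4 : 2 * (σ * σ) + 7 * σ + 2 ≤ 4 * (σ * σ * σ) := by nlinarith
  have e5 : 7 * (σ * σ * σ) ≤ σ ^ 6 :=
    calc 7 * (σ * σ * σ) ≤ σ * σ * σ * (σ * σ * σ) := Nat.mul_le_mul_right _ (by omega)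
      _ = σ ^ 6 := by ring
  omega

/-- The numerator budgets: one affine round inside the closed form `σ^{24 i + 54}`.
[folklore] -/
private theorem num_budget_le {σ i S T : ℕ} (hσ : 2 ≤ σ) (hS : S ≤ σ ^ (24 * i + 54))
    (hT : T + 3 * σ ≤ σ ^ 6) :
    4 * (S + 3 * σ) * (T + 3 * σ) ^ 2 + 178 * (T + 3 * σ) ^ 5 ≤ σ ^ (24 * (i + 1) + 54) := by
  have h3σ : 3 * σ ≤ σ ^ (24 * i + 54) :=
    calc 3 * σ ≤ σ * σ * σ := by nlinarith [Nat.mul_le_mul hσ hσ]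
      _ = σ ^ 3 := by ring
      _ ≤ σ ^ (24 * i + 54) := Nat.pow_le_pow_right (by omega) (by omega)
  have e1 : 4 * (S + 3 * σ) * (T + 3 * σ) ^ 2 ≤ 4 * (2 * σ ^ (24 * i + 54)) * (σ ^ 6) ^ 2 :=
    Nat.mul_le_mul (Nat.mul_le_mul_left 4 (by omega)) (Nat.pow_le_pow_left hT 2)
  have e2 : 178 * (T + 3 * σ) ^ 5 ≤ 178 * (σ ^ 6) ^ 5 :=
    Nat.mul_le_mul_left 178 (Nat.pow_le_pow_left hT 5)
  have e3 : 4 * (2 * σ ^ (24 * i + 54)) * (σ ^ 6) ^ 2 = 8 * σ ^ (24 * i + 66) := by ring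
  have e4 : 178 * (σ ^ 6) ^ 5 = 178 * σ ^ 30 := by ring
  have h8 : 8 ≤ σ ^ 3 := by
    calc 8 = 2 ^ 3 := by norm_num
      _ ≤ σ ^ 3 := Nat.pow_le_pow_left hσ 3
  have h256 : 178 ≤ σ ^ 8 := le_trans (by norm_num : 178 ≤ 2 ^ 8) (Nat.pow_le_pow_left hσ 8)
  have e5 : 8 * σ ^ (24 * i + 66) ≤ σ ^ (24 * i + 69) := by
    calc 8 * σ ^ (24 * i + 66) ≤ σ ^ 3 * σ ^ (24 * i + 66) := Nat.mul_le_mul_right _ h8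
      _ = σ ^ (24 * i + 69) := by ring
  have e6 : 178 * σ ^ 30 ≤ σ ^ (24 * i + 69) := by
    calc 178 * σ ^ 30 ≤ σ ^ 8 * σ ^ 30 := Nat.mul_le_mul_right _ h256
      _ = σ ^ 38 := by ring
      _ ≤ σ ^ (24 * i + 69) := Nat.pow_le_pow_right (by omega) (by omega)
  have e7 : 2 * σ ^ (24 * i + 69) ≤ σ ^ (24 * (i + 1) + 54) := by
    calc 2 * σ ^ (24 * i + 69) ≤ σ * σ ^ (24 * i + 69) := Nat.mul_le_mul_right _ hσ
      _ = σ ^ (24 * i + 70) := by ring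
      _ ≤ σ ^ (24 * (i + 1) + 54) := Nat.pow_le_pow_right (by omega) (by omega)
  omega

/-- **DDS Thm. 3.2, the trace-back ASSEMBLED — export of record: an exponent LINEAR in the
number of rounds.** Same transcript as `uabpComputes_of_traceBackTranscript`; conclusion
`UABPComputes (σ₀ ^ (648 · r + 1458)) f`. The numerator budget obeys the affine recursion
`S_j ≤ 4 (S_{j+1} + 3σ₀) s² + 178 s⁵` with `s ≤ σ₀⁶` bounding the stage's small data and all
denominators (which grow additively), whence `S_j ≤ σ₀^{24 (r−j) + 54}`; the last step costs the
factor `27` in the exponent. With `σ₀ = s^{O(7^{k−1})}` for the DiDIL stage objects (Claim 3.6) this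
is the printed `s^{O(k·7^k)}` ("This gives `S_0 = s^{O(k 7^k)}`").
[cite: DuttaDwivediSaxena2022, §3 proof of Thm. 3.2, Claims 3.6–3.8 and "Size blowup" (full version p0033 L886–890, p0034 L897 – p0036 L961)] -/
theorem uabpComputes_of_traceBackTranscript_lin {r d σ₀ : ℕ} (f : MvPolynomial (Fin n) F)
    (α : Fin n → F) (N E A B : ℕ → MvPolynomial (Fin (n + 1)) F)
    (e a βn Nw ew : ℕ → MvPolynomial (Fin n) F)
    {At Bt : MvPolynomial (Fin (n + 1)) F} {βt : MvPolynomial (Fin n) F}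
    (hN0 : N 0 = aeval (fun i : Fin n => (X 0 * X i.succ + C (α i) : MvPolynomial (Fin (n + 1)) F)) f)
    (hE0 : E 0 = 1)
    (hNs : ∀ j < r, N (j + 1) = pderiv 0 (N j * B j) * (E j * A j) - N j * B j * pderiv 0 (E j * A j))
    (hEs : ∀ j < r, E (j + 1) = (E j * A j) ^ 2)
    (he : ∀ j < r, truncDegreeOf 0 1 (E j) = rename Fin.succ (e j))
    (ha : ∀ j < r, truncDegreeOf 0 1 (A j) = rename Fin.succ (a j))
    (hβ : ∀ j < r, truncDegreeOf 0 1 (B j) = rename Fin.succ (βn j))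
    (he0 : ∀ j < r, e j ≠ 0) (ha0 : ∀ j < r, a j ≠ 0) (hβ0 : ∀ j < r, βn j ≠ 0)
    (hew0 : ∀ j < r, ew j ≠ 0)
    (hw0 : ∀ j < r, rename Fin.succ (ew j) * truncDegreeOf 0 1 (N j * B j) =
      rename Fin.succ (Nw j) * truncDegreeOf 0 1 (E j * A j))
    (hEP : ∀ j < r, UABPComputes σ₀ (E j)) (hAP : ∀ j < r, UABPComputes σ₀ (A j))
    (hBP : ∀ j < r, UABPComputes σ₀ (B j)) (heP : ∀ j < r, UABPComputes σ₀ (e j))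
    (haP : ∀ j < r, UABPComputes σ₀ (a j)) (hβP : ∀ j < r, UABPComputes σ₀ (βn j))
    (hNwP : ∀ j < r, UABPComputes σ₀ (Nw j)) (hewP : ∀ j < r, UABPComputes σ₀ (ew j))
    (htop : truncDegreeOf 0 (d - r) (N r * Bt) = truncDegreeOf 0 (d - r) (At * E r))
    (hβt : truncDegreeOf 0 1 Bt = rename Fin.succ βt) (hβt0 : βt ≠ 0)
    (hAtP : UABPComputes σ₀ At) (hBtP : UABPComputes σ₀ Bt) (hβtP : UABPComputes σ₀ βt)
    (hdeg : f.totalDegree < d) (hrd : r < d) (hdσ : d ≤ σ₀) (hσ : 2 ≤ σ₀) :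
    UABPComputes (σ₀ ^ (648 * r + 1458)) f := by
  -- invariant after `i` rounds: numerator within `σ₀^(24 i + 54)`, denominator within
  -- `2 + d σ₀ + i (3 d σ₀ + σ₀ + 4)`
  have key : ∀ i, i ≤ r → ∃ (Num : MvPolynomial (Fin (n + 1)) F) (den : MvPolynomial (Fin n) F),
      UABPComputes (σ₀ ^ (24 * i + 54)) Num ∧
      UABPComputes (2 + d * σ₀ + i * (3 * d * σ₀ + σ₀ + 4)) den ∧ den ≠ 0 ∧
      truncDegreeOf 0 (d - r + i) (rename Fin.succ den * N (r - i)) =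
        truncDegreeOf 0 (d - r + i) (Num * E (r - i)) := by
    intro i
    induction i with
    | zero =>
      intro _
      have hM : d - r = d - r - 1 + 1 := by omega
      rw [hM] at htop
      obtain ⟨Num, den, h1, h2, h3, h4⟩ := traceBack_top_known_lin (M := d - r - 1) (σ := σ₀)
        htop hβt hβt0 hAtP hBtP hβtP (by omega) hσ
      refine ⟨Num, den, h1.mono ?_, h2.mono ?_, h3, ?_⟩
      · calc 34 * σ₀ ^ 3 ≤ 2 ^ 51 * σ₀ ^ 3 := Nat.mul_le_mul_right _ (by norm_num)
          _ ≤ σ₀ ^ 51 * σ₀ ^ 3 := Nat.mul_le_mul_right _ (Nat.pow_le_pow_left hσ 51)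
          _ = σ₀ ^ (24 * 0 + 54) := by ring
      · have e1 : (d - r - 1 + 1) * σ₀ ≤ d * σ₀ := Nat.mul_le_mul_right σ₀ (by omega)
        omega
      · have e0 : d - r + 0 = d - r - 1 + 1 := by omega
        simp only [e0, Nat.sub_zero]
        exact h4
    | succ i ih =>
      intro hi
      obtain ⟨Num', den', hNum', hden', hden0', hcongr'⟩ := ih (by omega)
      have hjr : r - (i + 1) < r := by omega
      have hj1 : r - i = r - (i + 1) + 1 := by omega
      rw [hj1, hNs _ hjr, hEs _ hjr] at hcongr'
      obtain ⟨Num, den, h1, h2, h3, h4⟩ := traceBack_round_known_lin (M := d - r + i) (σ := σ₀)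
        hcongr' (he _ hjr) (ha _ hjr) (hβ _ hjr) (he0 _ hjr) (ha0 _ hjr) (hβ0 _ hjr) hden0'
        (hew0 _ hjr) (hw0 _ hjr) (hEP _ hjr) (hAP _ hjr) (hBP _ hjr) (heP _ hjr) (haP _ hjr)
        (hβP _ hjr) (hNwP _ hjr) (hewP _ hjr) hNum' hden' (by omega) hσ
      refine ⟨Num, den, h1.mono (num_budget_le hσ le_rfl ?_), h2.mono ?_, h3, h4⟩
      · exact den_budget_le hσ hdσ hrd (by omega)
      · have e1 : 3 * (d - r + i + 1) * σ₀ ≤ 3 * d * σ₀ :=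
          Nat.mul_le_mul_right σ₀ (Nat.mul_le_mul_left 3 (by omega))
        have e2 : (i + 1) * (3 * d * σ₀ + σ₀ + 4) = i * (3 * d * σ₀ + σ₀ + 4) + (3 * d * σ₀ + σ₀ + 4) := by
          ring
        omega
  obtain ⟨Num, den, h1, h2, h3, h4⟩ := key r le_rfl
  rw [Nat.sub_self, show d - r + r = d from by omega, hN0, hE0] at h4
  have hσ' : 2 ≤ σ₀ ^ (24 * r + 54) := le_trans hσ (Nat.le_self_pow (by omega) σ₀)
  have hden : UABPComputes (σ₀ ^ (24 * r + 54)) den := by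
    refine h2.mono (le_trans ?_ (Nat.pow_le_pow_right (by omega) (show 6 ≤ 24 * r + 54 by omega)))
    have := den_budget_le (i := r) hσ hdσ hrd le_rfl
    omega
  have h := uabpComputes_of_known_zero f α h4 h1 hden h3 hdeg
    (le_trans hdσ (Nat.le_self_pow (by omega) σ₀)) hσ'
  rw [← pow_mul] at h
  refine h.mono (le_of_eq ?_)
  ring_nf

/-- **The denominators' data come for free**: from `E_0 = 1`, `E_{j+1} = (E_j A_j)²` and the
divisors' `z = 0` values `a_j ≠ 0` (programs within `σ₀`), every `E_j|_{z=0}` is a `z`-free NONZERO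
polynomial `e_j` (`e_0 = 1`, `e_{j+1} = (e_j a_j)²`) and `E_j, e_j` have programs within
`3^j · 4σ₀` (repeated squaring). [cite: DuttaDwivediSaxena2022, §3 proof of Thm. 3.2, "Size blowup" (full version p0036 L952–958)] -/
theorem exists_traceBack_den_data {r σ₀ : ℕ} (E A : ℕ → MvPolynomial (Fin (n + 1)) F)
    (a : ℕ → MvPolynomial (Fin n) F) (hE0 : E 0 = 1)
    (hEs : ∀ j < r, E (j + 1) = (E j * A j) ^ 2)
    (ha : ∀ j < r, truncDegreeOf 0 1 (A j) = rename Fin.succ (a j)) (ha0 : ∀ j < r, a j ≠ 0)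
    (hAP : ∀ j < r, UABPComputes σ₀ (A j)) (haP : ∀ j < r, UABPComputes σ₀ (a j)) (hσ : 2 ≤ σ₀) :
    ∀ j, j ≤ r → ∃ ej : MvPolynomial (Fin n) F,
      truncDegreeOf 0 1 (E j) = rename Fin.succ ej ∧ ej ≠ 0 ∧
      UABPComputes (3 ^ j * (4 * σ₀)) ej ∧ UABPComputes (3 ^ j * (4 * σ₀)) (E j) := by
  intro j
  induction j with
  | zero =>
    intro _
    have h1 : UABPComputes (3 ^ 0 * (4 * σ₀)) (1 : MvPolynomial (Fin n) F) := by
      have h := (UABPComputesLen.of_C (n := n) (S := 2) le_rfl (1 : F)).uabpComputes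
      rw [C_1] at h
      exact h.mono (by omega)
    have h1' : UABPComputes (3 ^ 0 * (4 * σ₀)) (1 : MvPolynomial (Fin (n + 1)) F) := by
      have h := (UABPComputesLen.of_C (n := n + 1) (S := 2) le_rfl (1 : F)).uabpComputes
      rw [C_1] at h
      exact h.mono (by omega)
    refine ⟨1, ?_, one_ne_zero, h1, by rw [hE0]; exact h1'⟩
    rw [hE0, truncDegreeOf_eq_self_of_degreeOf_eq_zero (degreeOf_one _) Nat.one_pos]
    exact (map_one (rename (Fin.succ : Fin n → Fin (n + 1)))).symm
  | succ j ih =>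
    intro hj
    obtain ⟨ej, h1, h2, h3, h4⟩ := ih (by omega)
    have hjr : j < r := by omega
    have hb : 2 + 2 * (3 ^ j * (4 * σ₀) + σ₀) ≤ 3 ^ (j + 1) * (4 * σ₀) := by
      have h3j : 1 ≤ 3 ^ j := Nat.one_le_pow j 3 (by norm_num)
      have e1 : 3 ^ (j + 1) * (4 * σ₀) = 3 * (3 ^ j * (4 * σ₀)) := by ring
      have e2 : 4 * σ₀ ≤ 3 ^ j * (4 * σ₀) := Nat.le_mul_of_pos_left _ (by omega)
      omega
    refine ⟨(ej * a j) ^ 2, ?_, pow_ne_zero _ (mul_ne_zero h2 (ha0 j hjr)), ?_, ?_⟩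
    · rw [hEs j hjr, sq, sq, truncDegreeOf_one_mul, truncDegreeOf_one_mul, h1, ha j hjr, map_mul,
        map_mul]
    · exact ((h3.mul (haP j hjr)).pow 2).mono hb
    · rw [hEs j hjr]
      exact ((h4.mul (hAP j hjr)).pow 2).mono hb

/-- **The export of record without the denominators' data**: as
`uabpComputes_of_traceBackTranscript_lin`, with `E_j|_{z=0}` and the programs of `E_j` DERIVED
(`exists_traceBack_den_data`); the uniform budget `σ₁ ≥ max(σ₀, 3^r · 4σ₀)` absorbs the repeated
squaring. [cite: DuttaDwivediSaxena2022, §3 proof of Thm. 3.2, Claims 3.6–3.8 and "Size blowup" (full version p0033 L886–890, p0034 L897 – p0036 L961)] -/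
theorem uabpComputes_of_traceBackTranscript_lin' {r d σ₀ σ₁ : ℕ} (f : MvPolynomial (Fin n) F)
    (α : Fin n → F) (N E A B : ℕ → MvPolynomial (Fin (n + 1)) F)
    (a βn Nw ew : ℕ → MvPolynomial (Fin n) F)
    {At Bt : MvPolynomial (Fin (n + 1)) F} {βt : MvPolynomial (Fin n) F}
    (hN0 : N 0 = aeval (fun i : Fin n => (X 0 * X i.succ + C (α i) : MvPolynomial (Fin (n + 1)) F)) f)
    (hE0 : E 0 = 1)
    (hNs : ∀ j < r, N (j + 1) = pderiv 0 (N j * B j) * (E j * A j) - N j * B j * pderiv 0 (E j * A j))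
    (hEs : ∀ j < r, E (j + 1) = (E j * A j) ^ 2)
    (ha : ∀ j < r, truncDegreeOf 0 1 (A j) = rename Fin.succ (a j))
    (hβ : ∀ j < r, truncDegreeOf 0 1 (B j) = rename Fin.succ (βn j))
    (ha0 : ∀ j < r, a j ≠ 0) (hβ0 : ∀ j < r, βn j ≠ 0) (hew0 : ∀ j < r, ew j ≠ 0)
    (hw0 : ∀ j < r, rename Fin.succ (ew j) * truncDegreeOf 0 1 (N j * B j) =
      rename Fin.succ (Nw j) * truncDegreeOf 0 1 (E j * A j))
    (hAP : ∀ j < r, UABPComputes σ₀ (A j)) (hBP : ∀ j < r, UABPComputes σ₀ (B j))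
    (haP : ∀ j < r, UABPComputes σ₀ (a j)) (hβP : ∀ j < r, UABPComputes σ₀ (βn j))
    (hNwP : ∀ j < r, UABPComputes σ₀ (Nw j)) (hewP : ∀ j < r, UABPComputes σ₀ (ew j))
    (htop : truncDegreeOf 0 (d - r) (N r * Bt) = truncDegreeOf 0 (d - r) (At * E r))
    (hβt : truncDegreeOf 0 1 Bt = rename Fin.succ βt) (hβt0 : βt ≠ 0)
    (hAtP : UABPComputes σ₀ At) (hBtP : UABPComputes σ₀ Bt) (hβtP : UABPComputes σ₀ βt)
    (hdeg : f.totalDegree < d) (hrd : r < d) (hdσ : d ≤ σ₀) (hσ : 2 ≤ σ₀)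
    (hσ₀₁ : σ₀ ≤ σ₁) (hσ₁ : 3 ^ r * (4 * σ₀) ≤ σ₁) :
    UABPComputes (σ₁ ^ (648 * r + 1458)) f := by
  classical
  have hdata := exists_traceBack_den_data E A a hE0 hEs ha ha0 hAP haP hσ
  -- choose the `z = 0` values of the denominators
  let e : ℕ → MvPolynomial (Fin n) F := fun j =>
    if h : j ≤ r then Classical.choose (hdata j h) else 0
  have he_spec : ∀ j, j < r → truncDegreeOf 0 1 (E j) = rename Fin.succ (e j) ∧ e j ≠ 0 ∧
      UABPComputes (3 ^ j * (4 * σ₀)) (e j) ∧ UABPComputes (3 ^ j * (4 * σ₀)) (E j) := by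
    intro j hj
    have h := Classical.choose_spec (hdata j hj.le)
    simp only [e, dif_pos hj.le]
    exact h
  have hpow : ∀ j, j < r → 3 ^ j * (4 * σ₀) ≤ σ₁ := fun j hj =>
    le_trans (Nat.mul_le_mul_right _ (Nat.pow_le_pow_right (by norm_num) hj.le)) hσ₁
  exact uabpComputes_of_traceBackTranscript_lin (σ₀ := σ₁) f α N E A B e a βn Nw ew hN0 hE0 hNs hEs
    (fun j hj => (he_spec j hj).1) ha hβ (fun j hj => (he_spec j hj).2.1) ha0 hβ0 hew0 hw0
    (fun j hj => ((he_spec j hj).2.2.2).mono (hpow j hj)) (fun j hj => (hAP j hj).mono hσ₀₁)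
    (fun j hj => (hBP j hj).mono hσ₀₁) (fun j hj => ((he_spec j hj).2.2.1).mono (hpow j hj))
    (fun j hj => (haP j hj).mono hσ₀₁) (fun j hj => (hβP j hj).mono hσ₀₁)
    (fun j hj => (hNwP j hj).mono hσ₀₁) (fun j hj => (hewP j hj).mono hσ₀₁) htop hβt hβt0
    (hAtP.mono hσ₀₁) (hBtP.mono hσ₀₁) (hβtP.mono hσ₀₁) hdeg hrd (le_trans hdσ hσ₀₁)
    (le_trans hσ hσ₀₁)

end Linear

/-! ## The link to a producer's chain: `g_j = z^{[j ≥ 1]} · N_j / E_j`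

A producer's stage objects live in the fraction field `F(z, x)`: `g_0 = Φ_α(f)` and
`g_{j+1} = z ∂_z (g_j / t_j)` — the DiDIL recursion (3.1)–(3.2) in the Euler normalisation
(`Σ x_i ∂_i` becomes `z ∂_z` under the dilation `x_i ↦ z x_i`), `∂_z` extended to fractions by the
quotient rule. When the divisor is fed as `t_j = z^{[j ≥ 1]} · A_j / B_j` (its `z`-adic initial
forms moved into `A_j, B_j`, which therefore have nonzero `z = 0` values — the transcript's
`ha0/hβ0`), the VIRTUAL sequences `N, E` DEFINED by the transcript recursion (`hNs/hEs` by `rfl`)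
satisfy `g_j = z^{[j ≥ 1]} · N_j / E_j` EXACTLY. This is the only place where the Euler frame's
`z`-valuations are booked: the transcript's `hw0` (Claim 3.8's value `(f_j/t_j)|_{z=0}`, read off
`g_j / t_j = (N_j B_j)/(E_j A_j)`) and `htop` (read off `N_r / E_r = g_r / z^{[r ≥ 1]}`) are then
statements about `N, E`. `[j ≥ 1]` is written `min j 1`. -/

section Link

variable {F : Type*} [Field F] {n : ℕ} {L : Type*} [Field L]
  [Algebra (MvPolynomial (Fin (n + 1)) F) L] {R : Type*} [CommRing R] [Algebra R L]

/-- **The link lemma** (any derivation `D` of a field `L ⊇ F[z, x]` extending `∂_z`, with `z ≠ 0`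
in `L`): if `g_0 = N_0`, `g_{j+1} = z · D (g_j / t_j)` with `t_j = z^{min j 1} · A_j / B_j`, and
`N, E` obey the transcript recursion `N_{j+1} = ∂_z(N_j B_j) · (E_j A_j) − N_j B_j · ∂_z(E_j A_j)`,
`E_{j+1} = (E_j A_j)²`, `E_0 = 1`, then `g_j = z^{min j 1} · N_j / E_j` for every `j ≤ r` — the
`z` produced by `z ∂_z` in round `j` is the one absorbed by the divisor `t_{j+1}`. No
non-vanishing hypotheses: the quotient rule `D(a/b) = (D a · b − a · D b)/b²` holds in a field
unconditionally.
[cite: DuttaDwivediSaxena2022, §3 proof of Thm. 3.2, (3.1)–(3.2) and Claim 3.7 "Roadmap" (full version p0029 L766–767, p0030 L808–812, p0034 L897–906)] -/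
theorem traceBack_link {r : ℕ} (D : Derivation R L L)
    (hD : ∀ p : MvPolynomial (Fin (n + 1)) F,
      D (algebraMap _ L p) = algebraMap _ L (pderiv 0 p))
    (hz : algebraMap (MvPolynomial (Fin (n + 1)) F) L (X 0) ≠ 0)
    (N E A B : ℕ → MvPolynomial (Fin (n + 1)) F) (g t : ℕ → L) (hE0 : E 0 = 1)
    (hNs : ∀ j < r,
      N (j + 1) = pderiv 0 (N j * B j) * (E j * A j) - N j * B j * pderiv 0 (E j * A j))
    (hEs : ∀ j < r, E (j + 1) = (E j * A j) ^ 2)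
    (hg0 : g 0 = algebraMap _ L (N 0))
    (ht : ∀ j < r, t j = algebraMap (MvPolynomial (Fin (n + 1)) F) L (X 0) ^ min j 1 * algebraMap _ L (A j) / algebraMap _ L (B j))
    (hgs : ∀ j < r, g (j + 1) = algebraMap (MvPolynomial (Fin (n + 1)) F) L (X 0) * D (g j / t j)) :
    ∀ j ≤ r, g j = algebraMap (MvPolynomial (Fin (n + 1)) F) L (X 0) ^ min j 1 * algebraMap _ L (N j) / algebraMap _ L (E j) := by
  intro j
  induction j with
  | zero =>
    intro _
    rw [hg0, hE0, Nat.zero_min, pow_zero, one_mul, map_one, div_one]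
  | succ j ih =>
    intro hj
    have hj' : j < r := hj
    have hq : g j / t j = algebraMap _ L (N j * B j) / algebraMap _ L (E j * A j) := by
      rw [ih hj'.le, ht j hj', map_mul, map_mul, div_div_div_eq, mul_assoc,
        mul_left_comm (algebraMap _ L (E j)), mul_div_mul_left _ _ (pow_ne_zero _ hz)]
    rw [hgs j hj', hq, D.leibniz_div, hD, hD, hNs j hj', hEs j hj',
      show min (j + 1) 1 = 1 from Nat.min_eq_right (Nat.succ_le_succ (Nat.zero_le j)), pow_one]
    simp only [smul_eq_mul, map_sub, map_mul, map_pow]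
    rw [div_eq_mul_inv]
    ring

/-- The link lemma for `∂_z` extended to (any model `L` of) the fraction field `Frac F[z, x]` by
the quotient rule — `locDeriv (pderiv 0)` of `DDS21GradedFractions.lean`; `z ≠ 0` there because
`F[z, x] → L` is injective.
[cite: DuttaDwivediSaxena2022, §3 proof of Thm. 3.2, (3.1)–(3.2) and Claim 3.7 "Roadmap" (full version p0029 L766–767, p0030 L808–812, p0034 L897–906)] -/
theorem traceBack_link_locDeriv {r : ℕ} [IsFractionRing (MvPolynomial (Fin (n + 1)) F) L]
    [Algebra F L] [IsScalarTower F (MvPolynomial (Fin (n + 1)) F) L]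
    (N E A B : ℕ → MvPolynomial (Fin (n + 1)) F) (g t : ℕ → L) (hE0 : E 0 = 1)
    (hNs : ∀ j < r,
      N (j + 1) = pderiv 0 (N j * B j) * (E j * A j) - N j * B j * pderiv 0 (E j * A j))
    (hEs : ∀ j < r, E (j + 1) = (E j * A j) ^ 2)
    (hg0 : g 0 = algebraMap _ L (N 0))
    (ht : ∀ j < r, t j = algebraMap (MvPolynomial (Fin (n + 1)) F) L (X 0) ^ min j 1 *
      algebraMap _ L (A j) / algebraMap _ L (B j))
    (hgs : ∀ j < r, g (j + 1) = algebraMap (MvPolynomial (Fin (n + 1)) F) L (X 0) *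
      locDeriv (L := L) (pderiv 0 : Derivation F (MvPolynomial (Fin (n + 1)) F) _)
        (nonZeroDivisors (MvPolynomial (Fin (n + 1)) F)) (g j / t j)) :
    ∀ j ≤ r, g j = algebraMap (MvPolynomial (Fin (n + 1)) F) L (X 0) ^ min j 1 *
      algebraMap _ L (N j) / algebraMap _ L (E j) :=
  traceBack_link _ (fun p => locDeriv_algebraMap _ _ p)
    ((map_ne_zero_iff _ (IsFractionRing.injective (MvPolynomial (Fin (n + 1)) F) L)).mpr
      (X_ne_zero 0)) N E A B g t hE0 hNs hEs hg0 ht hgs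

end Link

end DDS2021

end Literature.Computability.AlgebraicComplexity
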